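import Mathlib
import Summits.Ventures.PercRepro2.Defs
import Summits.Ventures.PercRepro2.Graph
import Summits.Ventures.PercRepro2.OneColourSwitch
import Summits.Ventures.PercRepro2.RegionHubSign
import Summits.Ventures.PercRepro2.SideSwitch
import Summits.Ventures.PercRepro2.SideSwitchComps
import Summits.Ventures.PercRepro2.SideSwitchM9
import Summits.Ventures.PercRepro2.TermSwitchDefs
import Summits.Ventures.PercRepro2.TermSwitchFibre
import Summits.Ventures.PercRepro2.TermSwitchCompsFibre
import Summits.Ventures.PercRepro2.TermSwitchMono
import Summits.Ventures.PercRepro2.TermSwitchM9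
import Summits.Ventures.PercRepro2.TermSwitchRestrict
import Summits.Ventures.PercRepro2.M9NoPocketDefs
import Summits.Ventures.PercRepro2.M9Unreached

/-!
# The `Y`-slice of the single-`d` sum: definitions and the half-fibre machinery (blind cell
PercRepro2, p3 g26, 2026-08-28; `proofs/P3-YSLICE.md` §1, §3)

For a non-mark `d` the **`Y`-slice** is the part of the single-`d` sum
`Σ_{Sep ∧ DOne(d)} σ_pq · σ_rs` over the colourings in which EVERY non-loop edge at `d` is
coloured `Y` (`StarY`, `ySlice`); on the slice `d` is never doubly reached
(`not_mem_M2_of_starY`), so the slice is a piece of the `DZero` sum of the terminal set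
`{r, s}` (`slice_iff_pair`) cut by a predicate that is NOT constant along the `{r, s}`-fibres.
It splits by the status of `d`: `d` in the `Y`-world (`ySliceK`) or unreached (`ySliceO`,
`ySlice_eq_add`).

The half-fibre machinery: for a representative `ρ` of the lane's fibration (`RepH` / `compsH`
/ `assignC` / `flipOH`) the paired kernel `pairKer T = (σ_pq(ρ_T) + σ_pq(ρ^O_T)) · σ_rs(ρ_T)`
is symmetric under the complement `T ↦ A ∖ T` when there is no `r–s` edge
(`sigma_rs_assignC_sdiff`, `pairKer_sdiff`), so its sum over the HALF `{C₀ ∉ T}` of the cube is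
half the full fibre sum of `TermSwitch.fibre_sum_nonpos` (`sum_pairKer_half_nonpos`).
Own work; std axioms.
-/

namespace Summit.Ventures.PercRepro2

namespace NoPocket

open Finset Classical RegionHub OneColourSwitch SideSwitch TermSwitch

variable {V : Type*} {E : Type*}
variable [Fintype V] [DecidableEq V] [Fintype E] [DecidableEq E]

section Defs

variable (ends : E → Sym2 V)

omit [Fintype V] [DecidableEq V] [Fintype E] [DecidableEq E] in
/-- Every non-loop edge at `d` is coloured `Y`. -/
def StarY (d : V) (ω : Config E) : Prop := ∀ e, d ∈ ends e → ¬ (ends e).IsDiag → ω e = true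

/-- The `Y`-slice of the single-`d` sum: `Σ_{Sep ∧ DOne(d), every edge at d is Y} σ_pq · σ_rs`. -/
noncomputable def ySlice (p q r s d : V) : ℤ :=
  ∑ ω : Config E, if sep2 ends p q r s ω ∧ DOne ends r s d ω ∧ StarY ends d ω then
    sigma ends ω p q * sigma ends ω r s else 0

/-- The reached half of the `Y`-slice: `d` in the `Y`-world. -/
noncomputable def ySliceK (p q r s d : V) : ℤ :=
  ∑ ω : Config E, if sep2 ends p q r s ω ∧ DOne ends r s d ω ∧ StarY ends d ω ∧
      d ∈ K2 ends r s ω then sigma ends ω p q * sigma ends ω r s else 0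

/-- The unreached half of the `Y`-slice: `d` in no world. -/
noncomputable def ySliceO (p q r s d : V) : ℤ :=
  ∑ ω : Config E, if sep2 ends p q r s ω ∧ DOne ends r s d ω ∧ StarY ends d ω ∧
      d ∉ K2 ends r s ω then sigma ends ω p q * sigma ends ω r s else 0

variable {ends}

omit [Fintype V] [DecidableEq V] in
/-- The `Y`-slice is the sum of its two halves. -/
lemma ySlice_eq_add (p q r s d : V) :
    ySlice ends p q r s d = ySliceK ends p q r s d + ySliceO ends p q r s d := by
  unfold ySlice ySliceK ySliceO
  rw [← Finset.sum_add_distrib]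
  refine Finset.sum_congr rfl (fun ω _ => ?_)
  by_cases h : sep2 ends p q r s ω ∧ DOne ends r s d ω ∧ StarY ends d ω
  · by_cases hK : d ∈ K2 ends r s ω
    · rw [if_pos h, if_pos ⟨h.1, h.2.1, h.2.2, hK⟩, if_neg (fun h' => h'.2.2.2 hK), add_zero]
    · rw [if_pos h, if_neg (fun h' => hK h'.2.2.2), if_pos ⟨h.1, h.2.1, h.2.2, hK⟩, zero_add]
  · rw [if_neg h, if_neg (fun h' => h ⟨h'.1, h'.2.1, h'.2.2.1⟩),
      if_neg (fun h' => h ⟨h'.1, h'.2.1, h'.2.2.1⟩), add_zero]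

end Defs

section StarLemmas

variable {ends : E → Sym2 V}

omit [Fintype V] [DecidableEq V] [Fintype E] [DecidableEq E] in
/-- Two colourings that agree on every non-loop edge have the same connections. -/
lemma conn_iff_of_eqOn_nondiag {ω ω' : Config E}
    (h : ∀ e, ¬ (ends e).IsDiag → ω e = ω' e) {a b : V} :
    Conn ends ω a b ↔ Conn ends ω' a b := by
  have hG : openGraph ends ω = openGraph ends ω' := by
    ext u v
    rw [openGraph_adj, openGraph_adj]
    constructor
    · rintro ⟨huv, e, he, hends⟩
      refine ⟨huv, e, ?_, hends⟩
      rw [← h e (by rw [hends]; exact fun hd => huv (Sym2.mk_isDiag_iff.1 hd))]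
      exact he
    · rintro ⟨huv, e, he, hends⟩
      refine ⟨huv, e, ?_, hends⟩
      rw [h e (by rw [hends]; exact fun hd => huv (Sym2.mk_isDiag_iff.1 hd))]
      exact he
  simp only [Conn, hG]

omit [Fintype V] [DecidableEq V] [Fintype E] [DecidableEq E] in
/-- The sign of a pair only sees the non-loop edges. -/
lemma sigma_eq_of_eqOn_nondiag {ω ω' : Config E}
    (h : ∀ e, ¬ (ends e).IsDiag → ω e = ω' e) (a b : V) :
    sigma ends ω a b = sigma ends ω' a b := by
  have e1 := conn_iff_of_eqOn_nondiag (ends := ends) h (a := a) (b := b)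
  have e2 := conn_iff_of_eqOn_nondiag (ends := ends) (ω := OneColourSwitch.compl ω)
    (ω' := OneColourSwitch.compl ω')
    (fun e he => by simp only [OneColourSwitch.compl, h e he]) (a := a) (b := b)
  unfold sigma
  rw [if_congr e1 rfl rfl, if_congr e2 rfl rfl]

omit [Fintype V] [DecidableEq V] [Fintype E] [DecidableEq E] in
/-- The sign of a pair flips with the colours. -/
lemma sigma_compl (ω : Config E) (a b : V) :
    sigma ends (OneColourSwitch.compl ω) a b = - sigma ends ω a b := by
  simp only [sigma, OneColourSwitch.compl_compl]
  ring

omit [Fintype V] [DecidableEq V] [Fintype E] [DecidableEq E] in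
/-- A vertex with every non-loop edge `Y` lies in no `W`-cluster of another vertex. -/
lemma not_conn_compl_of_starY {d : V} {ω : Config E} (h : StarY ends d ω) {x : V} (hx : x ≠ d) :
    ¬ Conn ends (OneColourSwitch.compl ω) x d := by
  intro hc
  have key : d ∈ {y | y ≠ d} := by
    refine mem_of_conn_of_closed (S := {y | y ≠ d}) ?_ hx hc
    intro a ha b hab
    obtain ⟨hne, e, he, hends⟩ := openGraph_adj.1 hab
    rintro rfl
    have hd : b ∈ ends e := by rw [hends]; exact Sym2.mem_mk_right _ _
    have hnd : ¬ (ends e).IsDiag := by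
      rw [hends]; exact fun hd' => hne (Sym2.mk_isDiag_iff.1 hd')
    have := h e hd hnd
    simp [OneColourSwitch.compl, this] at he
  exact key rfl

omit [Fintype V] [DecidableEq V] [Fintype E] [DecidableEq E] in
/-- A vertex with every non-loop edge `Y` is not in the `W`-world of `{r, s}`. -/
lemma not_mem_M2_of_starY {r s d : V} (hr : d ≠ r) (hs : d ≠ s) {ω : Config E}
    (h : StarY ends d ω) : d ∉ M2 ends r s ω := by
  intro hM
  rcases mem_M2_iff.1 hM with hc | hc
  · exact not_conn_compl_of_starY h hr.symm hc
  · exact not_conn_compl_of_starY h hs.symm hc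

omit [Fintype V] [DecidableEq V] [Fintype E] [DecidableEq E] in
/-- `Sep` gives the two-colour separation of the terminal set `{r, s}`. -/
lemma sepH_pair_of_sep2 {p q r s : V} {ω : Config E} (h : sep2 ends p q r s ω) :
    sepH ends p q ({r, s} : Set V) ω := by
  obtain ⟨⟨hpr, hps, hqr, hqs⟩, ⟨hpr', hps', hqr', hqs'⟩⟩ := h
  refine ⟨?_, ?_, ?_, ?_⟩
  · rintro ⟨h, hh, hc⟩
    simp only [Set.mem_insert_iff, Set.mem_singleton_iff] at hh
    rcases hh with rfl | rfl
    · exact hpr (conn_symm hc)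
    · exact hps (conn_symm hc)
  · rintro ⟨h, hh, hc⟩
    simp only [Set.mem_insert_iff, Set.mem_singleton_iff] at hh
    rcases hh with rfl | rfl
    · exact hqr (conn_symm hc)
    · exact hqs (conn_symm hc)
  · rintro ⟨h, hh, hc⟩
    simp only [Set.mem_insert_iff, Set.mem_singleton_iff] at hh
    rcases hh with rfl | rfl
    · exact hpr' (conn_symm hc)
    · exact hps' (conn_symm hc)
  · rintro ⟨h, hh, hc⟩
    simp only [Set.mem_insert_iff, Set.mem_singleton_iff] at hh
    rcases hh with rfl | rfl
    · exact hqr' (conn_symm hc)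
    · exact hqs' (conn_symm hc)

omit [Fintype V] [DecidableEq V] [Fintype E] [DecidableEq E] in
/-- On the `Y`-slice, `DOne` is `DZero` of the terminal set `{r, s}`. -/
lemma DZeroH_pair_of_DOne_starY {r s d : V} (hr : d ≠ r) (hs : d ≠ s) {ω : Config E}
    (hD : DOne ends r s d ω) (hY : StarY ends d ω) : DZeroH ends ({r, s} : Set V) ω := by
  intro x hxH hxK hxM
  have hxr : x ≠ r := fun h => hxH (by rw [h]; simp)
  have hxs : x ≠ s := fun h => hxH (by rw [h]; simp)
  by_cases hxd : x = d
  · subst hxd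
    exact not_mem_M2_of_starY hr hs hY hxM
  · exact hD x hxr hxs hxd hxK hxM

omit [Fintype V] [DecidableEq V] [Fintype E] [DecidableEq E] in
/-- `Sep ∧ DOne` on the slice, in terminal-set language. -/
lemma slice_iff_pair {p q r s d : V} (hr : d ≠ r) (hs : d ≠ s) {ω : Config E} :
    (sep2 ends p q r s ω ∧ DOne ends r s d ω ∧ StarY ends d ω) ↔
      ((sepH ends p q ({r, s} : Set V) ω ∧ DZeroH ends ({r, s} : Set V) ω) ∧
        StarY ends d ω) := by
  constructor
  · rintro ⟨h1, h2, h3⟩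
    exact ⟨⟨sepH_pair_of_sep2 h1, DZeroH_pair_of_DOne_starY hr hs h2 h3⟩, h3⟩
  · rintro ⟨⟨h1, h2⟩, h3⟩
    refine ⟨sep2_of_sepH (by simp) (by simp) h1, ?_, h3⟩
    intro x hxr hxs _ hxK
    have hxH : x ∉ ({r, s} : Set V) := by
      simp only [Set.mem_insert_iff, Set.mem_singleton_iff, not_or]
      exact ⟨hxr, hxs⟩
    exact not_mem_both_of_DZeroH (by simp) (by simp) h2 hxH hxK

end StarLemmas

section Half

variable {ends : E → Sym2 V}

/-- The paired kernel of a representative: `(σ_pq(ρ_T) + σ_pq(ρ^O_T)) · σ_rs(ρ_T)`. -/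
noncomputable def pairKer (ends : E → Sym2 V) (p q r s : V) (H : Set V) (ρ : Config E)
    (T : Finset (Finset V)) : ℤ :=
  (sigma ends (assignC ends T ρ) p q + sigma ends (assignC ends T (flipOH ends H ρ)) p q) *
    sigma ends (assignC ends T ρ) r s

/-- The full fibre sum of the paired kernel is non-positive (`fibre_sum_nonpos`). -/
lemma sum_pairKer_nonpos {p q : V} {H : Set V} {ρ : Config E} (hρ : ρ ∈ RepH ends p q H)
    {r : V} (hr : r ∈ H) (s : V) :
    ∑ T ∈ (compsH ends H ρ).powerset, pairKer ends p q r s H ρ T ≤ 0 :=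
  fibre_sum_nonpos hρ hr s

omit [Fintype V] [DecidableEq V] [Fintype E] [DecidableEq E] in
/-- Without `r–s` edges, every edge within `{r, s}` is a loop. -/
lemma isDiag_of_within_pair {r s : V} (hrs : ∀ e, ends e ≠ s(r, s)) {e : E}
    (he : e ∈ within ends ({r, s} : Set V)) : (ends e).IsDiag := by
  obtain ⟨x, hx, y, hy, hxy⟩ := he
  simp only [Set.mem_insert_iff, Set.mem_singleton_iff] at hx hy
  rw [hxy]
  rcases hx with rfl | rfl <;> rcases hy with rfl | rfl
  · exact Sym2.mk_isDiag_iff.2 rfl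
  · exact (hrs e hxy).elim
  · exact (hrs e (by rw [hxy, Sym2.eq_swap])).elim
  · exact Sym2.mk_isDiag_iff.2 rfl

/-- **The `rs`-sign at the complementary assignment** is the opposite sign (no `r–s` edges). -/
lemma sigma_rs_assignC_sdiff {p q r s : V} {ρ : Config E}
    (hρ : ρ ∈ RepH ends p q ({r, s} : Set V)) (hrs : ∀ e, ends e ≠ s(r, s))
    {T : Finset (Finset V)} (hT : T ⊆ compsH ends ({r, s} : Set V) ρ) :
    sigma ends (assignC ends (compsH ends ({r, s} : Set V) ρ \ T) ρ) r s =
      - sigma ends (assignC ends T ρ) r s := by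
  have hTc : compsH ends ({r, s} : Set V) ρ \ T ⊆ compsH ends ({r, s} : Set V) ρ :=
    Finset.sdiff_subset
  -- `compl (ρ_{A ∖ T})` agrees with `ρ^O_T` on every non-loop edge
  have heq : ∀ e, ¬ (ends e).IsDiag →
      OneColourSwitch.compl (assignC ends (compsH ends ({r, s} : Set V) ρ \ T) ρ) e =
        assignC ends T (flipOH ends ({r, s} : Set V) ρ) e := by
    intro e he
    have hw : e ∉ within ends ({r, s} : Set V) := fun hw => he (isDiag_of_within_pair hrs hw)
    rw [compl_assignC_eq_off_H hρ hTc hw, unionT_sdiff_compsH hT,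
      Finset.sdiff_sdiff_eq_self (unionT_subset_A0H hT)]
    rfl
  have h1 : sigma ends (OneColourSwitch.compl
      (assignC ends (compsH ends ({r, s} : Set V) ρ \ T) ρ)) r s =
      sigma ends (assignC ends T (flipOH ends ({r, s} : Set V) ρ)) r s :=
    sigma_eq_of_eqOn_nondiag heq r s
  rw [← sigma_rs_assignC_flipOH (Set.mem_insert r _) s hT, ← h1, sigma_compl, neg_neg]

/-- **The paired kernel is symmetric under the complement of the assignment** (no `r–s`
edges): `pairKer (A ∖ T) = pairKer T`. -/
lemma pairKer_sdiff {p q r s : V} {ρ : Config E}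
    (hρ : ρ ∈ RepH ends p q ({r, s} : Set V)) (hrs : ∀ e, ends e ≠ s(r, s))
    {T : Finset (Finset V)} (hT : T ⊆ compsH ends ({r, s} : Set V) ρ) :
    pairKer ends p q r s ({r, s} : Set V) ρ (compsH ends ({r, s} : Set V) ρ \ T) =
      pairKer ends p q r s ({r, s} : Set V) ρ T := by
  have hTc : compsH ends ({r, s} : Set V) ρ \ T ⊆ compsH ends ({r, s} : Set V) ρ :=
    Finset.sdiff_subset
  have hself : compsH ends ({r, s} : Set V) ρ \ (compsH ends ({r, s} : Set V) ρ \ T) = T :=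
    Finset.sdiff_sdiff_eq_self hT
  have hpq : sigma ends (assignC ends (compsH ends ({r, s} : Set V) ρ \ T) ρ) p q +
      sigma ends (assignC ends (compsH ends ({r, s} : Set V) ρ \ T)
        (flipOH ends ({r, s} : Set V) ρ)) p q =
      - (sigma ends (assignC ends T ρ) p q +
        sigma ends (assignC ends T (flipOH ends ({r, s} : Set V) ρ)) p q) := by
    rw [sigma_pq_add_flipOH_C hρ hTc, sigma_pq_add_flipOH_C hρ hT, hself]
    ring
  unfold pairKer
  rw [hpq, sigma_rs_assignC_sdiff hρ hrs hT]
  ring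

/-- **The half-fibre sum**: over the assignments not containing a fixed component `C₀`, the
paired kernel sums to at most `0` (no `r–s` edges). -/
lemma sum_pairKer_half_nonpos {p q r s : V} {ρ : Config E}
    (hρ : ρ ∈ RepH ends p q ({r, s} : Set V)) (hrs : ∀ e, ends e ≠ s(r, s))
    {C₀ : Finset V} (hC₀ : C₀ ∈ compsH ends ({r, s} : Set V) ρ) :
    ∑ T ∈ (compsH ends ({r, s} : Set V) ρ).powerset,
      (if C₀ ∉ T then pairKer ends p q r s ({r, s} : Set V) ρ T else 0) ≤ 0 := by
  have hfull := sum_pairKer_nonpos hρ (Set.mem_insert r _) s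
  have hsplit : ∑ T ∈ (compsH ends ({r, s} : Set V) ρ).powerset,
      pairKer ends p q r s ({r, s} : Set V) ρ T =
      ∑ T ∈ (compsH ends ({r, s} : Set V) ρ).powerset,
        (if C₀ ∉ T then pairKer ends p q r s ({r, s} : Set V) ρ T else 0) +
        ∑ T ∈ (compsH ends ({r, s} : Set V) ρ).powerset,
          (if C₀ ∉ T then 0 else pairKer ends p q r s ({r, s} : Set V) ρ T) := by
    rw [← Finset.sum_add_distrib]
    refine Finset.sum_congr rfl (fun T _ => ?_)
    by_cases h : C₀ ∉ T
    · rw [if_pos h, if_pos h, add_zero]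
    · rw [if_neg h, if_neg h, zero_add]
  have hbij : ∑ T ∈ (compsH ends ({r, s} : Set V) ρ).powerset,
      (if C₀ ∉ T then 0 else pairKer ends p q r s ({r, s} : Set V) ρ T) =
      ∑ T ∈ (compsH ends ({r, s} : Set V) ρ).powerset,
        (if C₀ ∉ T then pairKer ends p q r s ({r, s} : Set V) ρ T else 0) := by
    rw [← sum_powerset_sdiff (compsH ends ({r, s} : Set V) ρ)
      (fun T => if C₀ ∉ T then 0 else pairKer ends p q r s ({r, s} : Set V) ρ T)]
    refine Finset.sum_congr rfl (fun T hT => ?_)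
    have hT := Finset.mem_powerset.1 hT
    have hmem : C₀ ∉ compsH ends ({r, s} : Set V) ρ \ T ↔ ¬ (C₀ ∉ T) := by
      rw [Finset.mem_sdiff, not_not]
      exact ⟨fun h => by_contra (fun h' => h ⟨hC₀, h'⟩), fun h h' => h'.2 h⟩
    rw [if_congr hmem rfl rfl, pairKer_sdiff hρ hrs hT]
    by_cases h : C₀ ∉ T
    · rw [if_neg (not_not.2 h), if_pos h]
    · rw [if_pos h, if_neg h]
  rw [hsplit, hbij] at hfull
  linarith

end Half

end NoPocket

end Summit.Ventures.PercRepro2
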